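import Summits.BirchSwinnertonDyer.BirchSwinnertonDyer.Theorems.WildThreeRankOneBSDpOfGlobalDivisibility
import Literature.NumberTheory.EllipticCurves.MatarNekovar2019.ShaStructureIrreducible
import HarnessLib

/-!
# The wild rank-one row at `3`, Manin-robust sockets (sequel of `WildThreeRankOneBSDpOfGlobalDivisibility.lean`):
# the TAM-FREE sub-leaf — the Kolyvagin side is PRINT, so STEP L at slack `0` + the rank-zero wild leaf ⟹
# `BSD₃(E)` —, the UNION (global divisibility + STEP L ⟹ `BSD₃(E)`), and the TOWER-FREE variants on
# Matar–Nekovář 2019 Thm. 0.7/§0.11 (route-free; cell `bsd-wall`, D-0131 (3) M-UTD, seat `bsd-wall-utd-p3` gen 1)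

ROUTE-FREE (imports no `Theses.*`). The first file produced the UPPER socket (co-STEP L at slack `v₃(c)`)
from global divisibility of the derived Heegner points + McCallum's Cor. 5.6 upper form, and the JET-PRODUCT
sub-leaf class theorem (IMC side idle). Here:

* §4a `bsdp_three_of_tamFree_of_stepL_of_wAllExclAddWildRankZero` — THE TAM-FREE SUB-LEAF: for `E` on
  `ClassO6 W 3`, `r_an = 1`, `ρ̄_{E,3}` onto (mod `3` only — NO tower binder), ONE Heegner datum with odd
  `d_K`, `L(E^{d_K},1) ≠ 0`, `3 ∤ ∏_ℓ c_ℓ(E)` and `3 ∤ c(Dt)`: the upper socket at slack `0` is Kolyvagin's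
  PRINTED bound (`upper_zero_of_kolyvagin_of_not_dvd_tamagawa`, named fact
  `Kolyvagin1990_padicValNat_card_sha_le`: McCallum 1991 §1, `p` odd, `ρ̄` onto, NO `p ∤ N` clause), so STEP L
  at slack `0` (`IndexLowerBoundLeAt W 3 K P 0` — the IMC side: the UTD kernel's cruxes #2–#4, or an
  Eisenstein-congruence lower bound — hypothesis) + the rank-zero wild leaf `WAllExclAddWildRankZero`
  (hypothesis) ⟹ `BSDp W 3`. A Kolyvagin-side crux is idle on this sub-leaf.
* §4b `bsdp_three_of_globalDivisibility_of_stepL_of_wAllExclAddWildRankZero` — THE UNION on the tower-onto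
  wild rank-one row: global `3^{s′}`-divisibility to depth `ord₃ ∏_ℓ c_ℓ(E) + v₃(c)` (Kolyvagin side,
  displayed) + STEP L at slack `v₃(c)` (IMC side, hypothesis) + the named facts + the leaf ⟹ `BSDp W 3` —
  the two research inputs are exactly the kernel 20390's two sockets in Manin-robust currency; §3 of the
  first file and §4a are its two one-sided sub-leaves.
* §5 `upper_of_globalDivisibility_of_surj`, `…_of_wAllExclAddWildRankZero_of_surj` (JET-PRODUCT) and
  `bsdp_three_of_globalDivisibility_of_stepL_of_wAllExclAddWildRankZero_of_surj` (UNION) — the SAME three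
  statements with the `3`-adic TOWER binder DROPPED: the structure-theorem input is Matar–Nekovář 2019
  Thm. 0.7 read through §0.11 (named fact
  `MatarNekovar2019.thm07_padicValNat_card_sha_primary_add_le_of_globalDivisibility_of_irreducible`: `p ≠ 2`,
  `ρ̄_{E,p}` irreducible, non-CM, `d_K ∉ {−3, −4}`, no reduction binder at `p`; the cell `bsd-potss` K8-t′/K9
  stub `stub_structureIrred` verbatim), so `ρ̄_{E,3}` onto — the row's own binder — suffices.

PARTITION currency (census `bsd-wall-census/blockA/BLOCK-A-index.md` T17, READ; onto-W `r_an = 1` residue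
3 894, R758: 3 893): TAM3FREE INDEX-EXCESS (`t3 = 0 < i3`, `c = 1`) **289** = §4a's habitat (STEP L + leaf
#6; at the certified `i3 ≥ 1` these need the IMC side genuinely: `ord₃ #Ш(E/K) ≥ 2`); JET-PRODUCT **3 413** =
§5's JET-PRODUCT habitat with NO image column beyond `ρ̄₃` onto; §4b/§5-UNION habitat = the whole row (tower
onto, resp. none). HONEST FRAMING: CONDITIONAL on the displayed inputs, the named facts
(hypotheses) and the leaf (hypothesis); per datum; closes no item and no class; «beyond-print theorem»: NO.
BSD is not proved for any curve by this file. No definition, no named fact, no `sorry`.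

References: [McCallumLMS1991] §1 Theorem (p. 296), §5 Cor. 5.6 (p. 310); [Jetchev2008] Conj. 1.3, Cor. 1.5
(p. 812); [MatarNekovar2019] Thm. 0.7 (p. 456), §0.11 (p. 457); [JetchevSkinnerWan2017] §7.4.1
(arXiv:1512.06894 p. 30); [GrossZagier1986] Thm. I.(6.3), V.§2; [Zywina2015] Prop. 1.14.
-/

noncomputable section

open scoped Classical

set_option linter.dupNamespace false
set_option autoImplicit false

namespace Summit.BirchSwinnertonDyer.BirchSwinnertonDyer.Theorems.SchneiderFree.Exact

open WeierstrassCurve NumberField IsDedekindDomain Field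
  Literature.NumberTheory.EllipticCurves
  Literature.NumberTheory.EllipticCurves.ModularForms
  Literature.NumberTheory.EllipticCurves.Rank1Residual
  Literature.NumberTheory.EllipticCurves.KrizLi2019
  Summit.BirchSwinnertonDyer.Rank1Residual
  Summit.BirchSwinnertonDyer.Rank1Residual.Additive
  Summit.BirchSwinnertonDyer.Rank1Residual.X11b
  Summit.BirchSwinnertonDyer.Rank1Residual.X11b.Three

/-! ### §4a THE TAM-FREE SUB-LEAF (the Kolyvagin side is print) -/

/-- **TAM-FREE sub-leaf of W-ALL row 2·3@3: STEP L at slack `0` + the rank-zero wild leaf ⟹ `BSD₃(E)`, the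
Kolyvagin side in print.** For `E` (globally minimal `W`) on `ClassO6 W 3` with `r_an(E) = 1` and `ρ̄_{E,3}`
onto (mod `3` only — no tower), ONE Heegner datum `(N = N_E, K, Dt, H, ι, P)` with odd `d_K`,
`L(E^{d_K},1) ≠ 0`, `3 ∤ ∏_ℓ c_ℓ(E)` and `3 ∤ c(Dt)`: Kolyvagin's PRINTED bound (`Kolyvagin1990_padicValNat_card_sha_le`,
hypothesis) is the upper socket at slack `0 = v₃(c)` (§1), so the LOWER socket `IndexLowerBoundLeAt W 3 K P 0`
(STEP L: `2·ord₃[E(K):ℤP] ≤ ord₃ #Ш(E/K)` here — the IMC side, hypothesis `hlo`) and the leaf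
`WAllExclAddWildRankZero` (hypothesis) give `BSDp W 3` (kmc g17's descent). On this sub-leaf a Kolyvagin-side
crux is idle. CONDITIONAL; per datum; closes nothing by itself.
[cite: McCallumLMS1991, §1 Theorem (Kolyvagin), p. 296] [cite: JetchevSkinnerWan2017, §7.4.1 (arXiv:1512.06894 p. 30)]
[cite: GrossZagier1986, Thm. I.(6.3) and V.§2] -/
theorem bsdp_three_of_tamFree_of_stepL_of_wAllExclAddWildRankZero
    (hGZ : ∀ (N : ℕ) [NeZero N] (W : WeierstrassCurve ℚ) (K : Type) [Field K] [NumberField K],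
      gross_zagier N W K)
    (hKo : ∀ (N : ℕ) [NeZero N] (W : WeierstrassCurve ℚ) (K : Type) [Field K] [NumberField K],
      kolyvagin N W K)
    (hB : ∀ (N : ℕ) [NeZero N] (W : WeierstrassCurve ℚ) (K : Type) [Field K] [NumberField K],
      Kolyvagin1990_padicValNat_card_sha_le N W K)
    (hGZK : rank_eq_analyticRank_of_analyticRank_le_one) (hmod : hasEntireLFunction_rat)
    (hGZ73 : GrossZagier1986_thm_I_7_3)
    (hRZ : Summit.BirchSwinnertonDyer.WAllExclAddWildRankZero)
    (W : WeierstrassCurve ℚ) [W.IsElliptic] [W.IsGloballyMinimal]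
    (hO6 : ClassO6 W 3) (hsurj : W.HasSurjectiveModNGaloisRep 3) (hr : W.analyticRank = 1)
    (N : ℕ) [NeZero N] (K : Type) [Field K] [NumberField K]
    (Dt : ModularParametrizationData W N) (H : HeegnerDatum N (NumberField.discr K)) (ι : K →+* ℂ)
    (P : (W.baseChange K).toAffine.Point)
    (hN : W.conductorNorm ℤ = N) (hK : IsImaginaryQuadratic K) (hodd : Odd (NumberField.discr K))
    (hHH : SatisfiesHeegnerHypothesis N K)
    (hLd : (W.quadraticTwist (NumberField.discr K : ℚ)).entireLFunction 1 ≠ 0)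
    (hP : WeierstrassCurve.Affine.Point.map ι.toRatAlgHom P = heegnerPointComplex Dt H)
    (htam : ¬ 3 ∣ W.tamagawaProduct) (hc : ¬ (3 : ℤ) ∣ Dt.c)
    (hlo : IndexLowerBoundLeAt W 3 K P 0) :
    BSDp W 3 := by
  -- the Heegner point is non-torsion (Gross–Zagier)
  have hL0 : W.entireLFunction 1 = 0 := entireLFunction_one_eq_zero_of_analyticRank_eq_one hr
  obtain ⟨-, hderiv⟩ := leadingLCoeff_eq_deriv_of_analyticRank_eq_one hr
  have hLK : LDerivEK W K ≠ 0 := by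
    rw [lDerivEK_eq_deriv_mul W K hmod hL0]; exact mul_ne_zero hderiv hLd
  have hnt : ¬ IsOfFinAddOrder P :=
    (lDerivEK_ne_zero_iff_not_isOfFinAddOrder W N K (hGZ N W K) hK hHH ⟨Dt, H, ι, hP⟩).mp hLK
  -- the upper socket at slack `0` is Kolyvagin's printed bound (§1)
  have hup0 : Upper.IndexUpperBoundLeAt W 3 K P 0 :=
    upper_zero_of_kolyvagin_of_not_dvd_tamagawa (hB N W K) (by decide) hsurj hK hHH Dt H ι hP hnt htam
  -- slack `v₃(c) = 0`
  have hc0 : padicValNat 3 Dt.c.natAbs = 0 :=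
    padicValNat.eq_zero_of_not_dvd fun h ↦ hc (Int.ofNat_dvd_left.mpr h)
  -- a globally minimal model of the twist, then kmc g17's descent with the rank-zero wild leaf
  have hD0 : (NumberField.discr K : ℚ) ≠ 0 := by exact_mod_cast NumberField.discr_ne_zero K
  haveI : (W.quadraticTwist (NumberField.discr K : ℚ)).IsElliptic := W.isElliptic_quadraticTwist hD0
  obtain ⟨Cd, hCd⟩ := hasGlobalMinimalModel_rat_holds (W.quadraticTwist (NumberField.discr K : ℚ))
  haveI : (Cd • W.quadraticTwist (NumberField.discr K : ℚ)).IsGloballyMinimal := hCd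
  exact bsdp_three_of_exactIndexManin_of_wAllExclAddWildRankZero hGZ hKo hGZK hmod hGZ73 hRZ W hO6 hsurj hr N
    K Dt H ι P (Cd • W.quadraticTwist (NumberField.discr K : ℚ)) hN hK hodd hHH hLd hP ⟨Cd, rfl⟩
    (hc0 ▸ hlo) (hc0 ▸ hup0)

/-! ### §4b THE UNION: both sockets as inputs -/

/-- **The UNION: global divisibility (Kolyvagin side) + STEP L at slack `v₃(c)` (IMC side) + the rank-zero
wild leaf ⟹ `BSD₃(E)` on the whole tower-onto wild rank-one row.** For `E` on `ClassO6 W 3`, `r_an = 1`,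
`ρ_{E,3^n}` onto for all `n`, ONE Heegner datum at level `N_E` with odd `d_K` and `L(E^{d_K},1) ≠ 0`: global
`3^{s′}`-divisibility of the derived Heegner points on the frame to depth `ord₃ ∏_ℓ c_ℓ(E) + v₃(c)`
(`hglob`, displayed), McCallum (named), STEP L at slack `v₃(c)` (`hlo` = `IndexLowerBoundLeAt W 3 K P (v₃ c)`,
the IMC-side input of the UTD kernel, hypothesis), the named facts and the leaf `WAllExclAddWildRankZero`
give `BSDp W 3`. The two research inputs are exactly the two sockets of the kernel 20390 in Manin-robust
currency; §3 and `bsdp_three_of_tamFree_of_stepL_of_wAllExclAddWildRankZero` are its two one-sided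
sub-leaves. CONDITIONAL; per datum. [cite: McCallumLMS1991, §5 Cor. 5.6 (p. 310)]
[cite: Jetchev2008, Conj. 1.3 and Cor. 1.5 (p. 812)] [cite: JetchevSkinnerWan2017, §7.4.1 (arXiv:1512.06894 p. 30)] -/
theorem bsdp_three_of_globalDivisibility_of_stepL_of_wAllExclAddWildRankZero
    (hGZ : ∀ (N : ℕ) [NeZero N] (W : WeierstrassCurve ℚ) (K : Type) [Field K] [NumberField K],
      gross_zagier N W K)
    (hKo : ∀ (N : ℕ) [NeZero N] (W : WeierstrassCurve ℚ) (K : Type) [Field K] [NumberField K],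
      kolyvagin N W K)
    (hGZK : rank_eq_analyticRank_of_analyticRank_le_one) (hmod : hasEntireLFunction_rat)
    (hGZ73 : GrossZagier1986_thm_I_7_3)
    (hMcU : McCallum1991_padicValNat_card_sha_primary_add_le_of_globalDivisibility)
    (hRZ : Summit.BirchSwinnertonDyer.WAllExclAddWildRankZero)
    (W : WeierstrassCurve ℚ) [W.IsElliptic] [W.IsGloballyMinimal] [NeZero (W.conductorNorm ℤ)]
    (hO6 : ClassO6 W 3) (hρ : ∀ n : ℕ, W.HasSurjectiveModNGaloisRep (3 ^ n : ℕ)) (hr : W.analyticRank = 1)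
    (K : Type) [Field K] [NumberField K]
    (Dt : ModularParametrizationData W (W.conductorNorm ℤ))
    (H : HeegnerDatum (W.conductorNorm ℤ) (NumberField.discr K)) (ι : K →+* ℂ)
    (P : (W.baseChange K).toAffine.Point)
    (hK : IsImaginaryQuadratic K) (hodd : Odd (NumberField.discr K))
    (hHH : SatisfiesHeegnerHypothesis (W.conductorNorm ℤ) K)
    (hLd : (W.quadraticTwist (NumberField.discr K : ℚ)).entireLFunction 1 ≠ 0)
    (hP : WeierstrassCurve.Affine.Point.map ι.toRatAlgHom P = heegnerPointComplex Dt H)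
    (hglob : ∀ (s' : ℕ), s' ≤ padicValNat 3 W.tamagawaProduct + padicValNat 3 Dt.c.natAbs →
      ∀ (n : ℕ) (d : KolyvaginHeegnerData Dt H.β ι n), Squarefree n →
        (∀ ℓ ∈ n.primeFactors, Zhang2014.IsKolyvaginPrime (W.conductorNorm ℤ) W K 3 ℓ ∧
          s' ≤ Zhang2014.kolyvaginIndex W 3 ℓ) → Koly.PDiv d 3 s')
    (hlo : IndexLowerBoundLeAt W 3 K P (padicValNat 3 Dt.c.natAbs)) :
    BSDp W 3 := by
  have hsurj : W.HasSurjectiveModNGaloisRep 3 := by simpa using hρ 1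
  have h3N : 3 ∣ W.conductorNorm ℤ :=
    (W.dvd_conductorNorm_iff_not_hasGoodReductionAtPrime 3).mpr (not_good_of_addv W 3 hO6.2.1)
  have h3 : NumberField.discr K ≠ -3 := by
    intro h
    exact (X11b.Three.not_dvd_discr_and_not_dvd_torsionOrder_of_heegner hK hHH (by decide) h3N).1
      (h ▸ ⟨-1, by norm_num⟩)
  have h4 : NumberField.discr K ≠ -4 := by
    intro h
    rw [h] at hodd
    exact (Int.not_odd_iff_even.mpr ⟨-2, by norm_num⟩) hodd
  have hL0 : W.entireLFunction 1 = 0 := entireLFunction_one_eq_zero_of_analyticRank_eq_one hr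
  obtain ⟨-, hderiv⟩ := leadingLCoeff_eq_deriv_of_analyticRank_eq_one hr
  have hLK : LDerivEK W K ≠ 0 := by
    rw [lDerivEK_eq_deriv_mul W K hmod hL0]; exact mul_ne_zero hderiv hLd
  have hnt : ¬ IsOfFinAddOrder P :=
    (lDerivEK_ne_zero_iff_not_isOfFinAddOrder W (W.conductorNorm ℤ) K (hGZ _ W K) hK hHH
      ⟨Dt, H, ι, hP⟩).mp hLK
  have hup : Upper.IndexUpperBoundLeAt W 3 K P (padicValNat 3 Dt.c.natAbs) :=
    upper_of_globalDivisibility hKo hMcU W 3 (by decide) hρ K hK h3 h4 hHH Dt H ι P hP hnt hglob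
  have hD0 : (NumberField.discr K : ℚ) ≠ 0 := by exact_mod_cast NumberField.discr_ne_zero K
  haveI : (W.quadraticTwist (NumberField.discr K : ℚ)).IsElliptic := W.isElliptic_quadraticTwist hD0
  obtain ⟨Cd, hCd⟩ := hasGlobalMinimalModel_rat_holds (W.quadraticTwist (NumberField.discr K : ℚ))
  haveI : (Cd • W.quadraticTwist (NumberField.discr K : ℚ)).IsGloballyMinimal := hCd
  exact bsdp_three_of_exactIndexManin_of_wAllExclAddWildRankZero hGZ hKo hGZK hmod hGZ73 hRZ W hO6 hsurj hr
    (W.conductorNorm ℤ) K Dt H ι P (Cd • W.quadraticTwist (NumberField.discr K : ℚ)) rfl hK hodd hHH hLd hP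
    ⟨Cd, rfl⟩ hlo hup

/-! ### §5 TOWER-FREE variants: Kolyvagin's structure theorem under IRREDUCIBILITY (Matar–Nekovář 2019 Thm. 0.7 / §0.11) -/

/-- **The receptacle with a mod-`p` image hypothesis only.** As `upper_of_globalDivisibility`, but the
structure-theorem input is Matar–Nekovář 2019 Thm. 0.7 read through §0.11 (named fact
`MatarNekovar2019.thm07_padicValNat_card_sha_primary_add_le_of_globalDivisibility_of_irreducible`: `p ≠ 2`,
`ρ̄_{E,p}` IRREDUCIBLE, non-CM, `d_K ∉ {−3, −4}`, NO `p`-adic tower, NO reduction binder at `p`; hypothesis),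
so `ρ̄_{E,p}` onto (mod `p` only: irreducible + non-CM by Zywina) suffices: global `p^{s′}`-divisibility of the
derived Heegner points on the frame `(Dt, H.β, ι)` to depth `ord_p ∏_ℓ c_ℓ(E) + s` (`hglob`, displayed) ⟹
`Upper.IndexUpperBoundLeAt W p K P s`. [cite: MatarNekovar2019, Thm. 0.7 (p. 456) and §0.11 (p. 457)]
[cite: McCallumLMS1991, §5 Cor. 5.6 (p. 310) and Lemma 5.1 (p. 303)] [cite: Jetchev2008, Conj. 1.3 and (1) (p. 812)] -/
theorem upper_of_globalDivisibility_of_surj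
    (hKo : ∀ (N : ℕ) [NeZero N] (W : WeierstrassCurve ℚ) (K : Type) [Field K] [NumberField K],
      kolyvagin N W K)
    (hMN : MatarNekovar2019.thm07_padicValNat_card_sha_primary_add_le_of_globalDivisibility_of_irreducible)
    (W : WeierstrassCurve ℚ) [W.IsElliptic] [W.IsGloballyMinimal] [NeZero (W.conductorNorm ℤ)]
    (p : ℕ) [Fact p.Prime] (hp2 : p ≠ 2) (hsurj : W.HasSurjectiveModNGaloisRep p)
    (K : Type) [Field K] [NumberField K] (hK : IsImaginaryQuadratic K)
    (h3 : NumberField.discr K ≠ -3) (h4 : NumberField.discr K ≠ -4)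
    (hHH : SatisfiesHeegnerHypothesis (W.conductorNorm ℤ) K)
    (Dt : ModularParametrizationData W (W.conductorNorm ℤ))
    (H : HeegnerDatum (W.conductorNorm ℤ) (NumberField.discr K)) (ι : K →+* ℂ)
    (P : (W.baseChange K).toAffine.Point)
    (hP : WeierstrassCurve.Affine.Point.map ι.toRatAlgHom P = heegnerPointComplex Dt H)
    (hnt : ¬ IsOfFinAddOrder P) {s : ℕ}
    (hglob : ∀ (s' : ℕ), s' ≤ padicValNat p W.tamagawaProduct + s →
      ∀ (n : ℕ) (d : KolyvaginHeegnerData Dt H.β ι n), Squarefree n →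
        (∀ ℓ ∈ n.primeFactors, Zhang2014.IsKolyvaginPrime (W.conductorNorm ℤ) W K p ℓ ∧
          s' ≤ Zhang2014.kolyvaginIndex W p ℓ) → Koly.PDiv d p s') :
    Upper.IndexUpperBoundLeAt W p K P s := by
  have hp : p.Prime := Fact.out
  have hCM : ¬ W.HasCM := fun hCM ↦ W.not_hasSurjectiveModNGaloisRep_of_hasCM hCM hp hp2 hsurj
  haveI : NeZero ((p : ℕ) : ℚ) := ⟨by exact_mod_cast hp.ne_zero⟩
  have hirr : W.HasIrreducibleModPGaloisRep p :=
    hasIrreducibleModPGaloisRep_of_hasSurjectiveModNGaloisRep W p hsurj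
  obtain ⟨hrank, hfin⟩ := hKo (W.conductorNorm ℤ) W K hK hHH ⟨Dt, H, ι, hP⟩ hnt
  haveI : Finite (W.baseChange K).sha := hfin
  have hbot := torsionBy_eq_bot_of_isImaginaryQuadratic_of_hasIrreducibleModPGaloisRep W K hK hp hirr
  have hiv : ∀ x : (W.baseChange K).toAffine.Point, p • x = 0 → x = 0 := fun x hx ↦ by
    have hmem : x ∈ AddSubgroup.torsionBy (W.baseChange K).toAffine.Point ((p : ℕ) : ℤ) := by
      rw [mem_torsionBy_iff, natCast_zsmul]
      exact hx
    rw [hbot] at hmem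
    exact hmem
  obtain ⟨d₁⟩ := exists_kolyvaginHeegnerData_one
    (phi_heegnerTau_mem_singularModuliField_holds (W.conductorNorm ℤ) W K) hK Dt H.β ι H.dvd_sq_sub
  have hPd : d₁.toGeomPoints d₁.derivedPoint = toGeomPoints (W.baseChange K) P :=
    KolyvaginBottom.toGeomPoints_derivedPoint_one_eq
      (heegnerPointOfConductor_one_galoisConj_holds (W.conductorNorm ℤ) W K) hK hHH hP d₁ rfl
  haveI : Module.Finite ℤ (W.baseChange K).toAffine.Point := (W.baseChange K).module_finite_point_holds
  obtain ⟨M₀, x₀, hx₀, hmax⟩ := exists_pow_smul_eq_and_forall_ne hnt (p := p) hp.two_le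
  have hdiv : ∃ Q : (W.baseChange K).toAffine.Point, ((p ^ M₀ : ℕ) : ℤ) • Q = P :=
    ⟨x₀, by rw [natCast_zsmul]; exact hx₀⟩
  have hndiv : ¬ ∃ Q : (W.baseChange K).toAffine.Point, ((p ^ (M₀ + 1) : ℕ) : ℤ) • Q = P := by
    rintro ⟨Q, hQ⟩
    exact hmax Q (by rw [← natCast_zsmul]; exact hQ)
  have hle : padicValNat p (Nat.card (AddCommGroup.primaryComponent (W.baseChange K).sha p)) +
      2 * (padicValNat p W.tamagawaProduct + s) ≤ 2 * M₀ :=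
    hMN W hCM K hK h3 h4 hHH p hp2 hirr Dt H.β ι d₁ P hPd hnt M₀ hdiv hndiv
      (padicValNat p W.tamagawaProduct + s) (fun s' hs' n d hn hℓ ↦ hglob s' hs' n d hn hℓ)
  have hsha : padicValNat p (W.baseChange K).shaOrder =
      padicValNat p (Nat.card (AddCommGroup.primaryComponent (W.baseChange K).sha p)) :=
    Koly.padicValNat_shaOrder_eq (W.baseChange K) p
  haveI : Finite (AddCommGroup.torsion (W.baseChange K).toAffine.Point) :=
    WeierstrassCurve.finite_torsion_point (W := W.baseChange K)
  obtain ⟨c, Q, hcQ, hcker⟩ := RankOne.exists_coord_of_mordellWeilRank_eq_one (W.baseChange K) hrank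
  have hidx : padicValNat p (AddSubgroup.zmultiples P).index = M₀ :=
    Koly.padicValNat_index_zmultiples_eq_of_divisibility c Q hcQ hcker hiv P hdiv hndiv
  unfold Upper.IndexUpperBoundLeAt
  rw [hidx, hsha]
  omega

/-- **JET-PRODUCT sub-leaf, mod-`3` image only (NO tower binder).** For `E` on `ClassO6 W 3`, `r_an = 1`,
`ρ̄_{E,3}` onto, ONE Heegner datum at level `N_E` with odd `d_K`, `L(E^{d_K},1) ≠ 0` and JET-exact index
`ord₃ [E(K):ℤP] = ord₃ ∏_ℓ c_ℓ(E) + v₃(c)`: global `3^{s′}`-divisibility on the frame to that depth (`hglob`,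
displayed) + Matar–Nekovář Thm. 0.7/§0.11 (named) + the named facts + the leaf `WAllExclAddWildRankZero` ⟹
`BSDp W 3`. Habitat: every JET-PRODUCT class of the onto-W rank-one residue (no `3`-adic image column
needed). CONDITIONAL; per datum. [cite: MatarNekovar2019, Thm. 0.7 (p. 456) and §0.11 (p. 457)]
[cite: Jetchev2008, Conj. 1.3 and Cor. 1.5 (p. 812)] [cite: JetchevSkinnerWan2017, §7.4.1 (arXiv:1512.06894 p. 30)] -/
theorem bsdp_three_of_indexEqTamagawaManin_of_globalDivisibility_of_wAllExclAddWildRankZero_of_surj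
    (hGZ : ∀ (N : ℕ) [NeZero N] (W : WeierstrassCurve ℚ) (K : Type) [Field K] [NumberField K],
      gross_zagier N W K)
    (hKo : ∀ (N : ℕ) [NeZero N] (W : WeierstrassCurve ℚ) (K : Type) [Field K] [NumberField K],
      kolyvagin N W K)
    (hGZK : rank_eq_analyticRank_of_analyticRank_le_one) (hmod : hasEntireLFunction_rat)
    (hGZ73 : GrossZagier1986_thm_I_7_3)
    (hMN : MatarNekovar2019.thm07_padicValNat_card_sha_primary_add_le_of_globalDivisibility_of_irreducible)
    (hRZ : Summit.BirchSwinnertonDyer.WAllExclAddWildRankZero)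
    (W : WeierstrassCurve ℚ) [W.IsElliptic] [W.IsGloballyMinimal] [NeZero (W.conductorNorm ℤ)]
    (hO6 : ClassO6 W 3) (hsurj : W.HasSurjectiveModNGaloisRep 3) (hr : W.analyticRank = 1)
    (K : Type) [Field K] [NumberField K]
    (Dt : ModularParametrizationData W (W.conductorNorm ℤ))
    (H : HeegnerDatum (W.conductorNorm ℤ) (NumberField.discr K)) (ι : K →+* ℂ)
    (P : (W.baseChange K).toAffine.Point)
    (hK : IsImaginaryQuadratic K) (hodd : Odd (NumberField.discr K))
    (hHH : SatisfiesHeegnerHypothesis (W.conductorNorm ℤ) K)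
    (hLd : (W.quadraticTwist (NumberField.discr K : ℚ)).entireLFunction 1 ≠ 0)
    (hP : WeierstrassCurve.Affine.Point.map ι.toRatAlgHom P = heegnerPointComplex Dt H)
    (hI : padicValNat 3 (AddSubgroup.zmultiples P).index =
      padicValNat 3 W.tamagawaProduct + padicValNat 3 Dt.c.natAbs)
    (hglob : ∀ (s' : ℕ), s' ≤ padicValNat 3 W.tamagawaProduct + padicValNat 3 Dt.c.natAbs →
      ∀ (n : ℕ) (d : KolyvaginHeegnerData Dt H.β ι n), Squarefree n →
        (∀ ℓ ∈ n.primeFactors, Zhang2014.IsKolyvaginPrime (W.conductorNorm ℤ) W K 3 ℓ ∧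
          s' ≤ Zhang2014.kolyvaginIndex W 3 ℓ) → Koly.PDiv d 3 s') :
    BSDp W 3 := by
  have h3N : 3 ∣ W.conductorNorm ℤ :=
    (W.dvd_conductorNorm_iff_not_hasGoodReductionAtPrime 3).mpr (not_good_of_addv W 3 hO6.2.1)
  have h3 : NumberField.discr K ≠ -3 := by
    intro h
    exact (X11b.Three.not_dvd_discr_and_not_dvd_torsionOrder_of_heegner hK hHH (by decide) h3N).1
      (h ▸ ⟨-1, by norm_num⟩)
  have h4 : NumberField.discr K ≠ -4 := by
    intro h
    rw [h] at hodd
    exact (Int.not_odd_iff_even.mpr ⟨-2, by norm_num⟩) hodd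
  have hL0 : W.entireLFunction 1 = 0 := entireLFunction_one_eq_zero_of_analyticRank_eq_one hr
  obtain ⟨-, hderiv⟩ := leadingLCoeff_eq_deriv_of_analyticRank_eq_one hr
  have hLK : LDerivEK W K ≠ 0 := by
    rw [lDerivEK_eq_deriv_mul W K hmod hL0]; exact mul_ne_zero hderiv hLd
  have hnt : ¬ IsOfFinAddOrder P :=
    (lDerivEK_ne_zero_iff_not_isOfFinAddOrder W (W.conductorNorm ℤ) K (hGZ _ W K) hK hHH
      ⟨Dt, H, ι, hP⟩).mp hLK
  have hup : Upper.IndexUpperBoundLeAt W 3 K P (padicValNat 3 Dt.c.natAbs) :=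
    upper_of_globalDivisibility_of_surj hKo hMN W 3 (by decide) hsurj K hK h3 h4 hHH Dt H ι P hP hnt hglob
  obtain ⟨-, hlo, -⟩ := indexBounds_of_upper_of_index_le hup hI.le
  have hD0 : (NumberField.discr K : ℚ) ≠ 0 := by exact_mod_cast NumberField.discr_ne_zero K
  haveI : (W.quadraticTwist (NumberField.discr K : ℚ)).IsElliptic := W.isElliptic_quadraticTwist hD0
  obtain ⟨Cd, hCd⟩ := hasGlobalMinimalModel_rat_holds (W.quadraticTwist (NumberField.discr K : ℚ))
  haveI : (Cd • W.quadraticTwist (NumberField.discr K : ℚ)).IsGloballyMinimal := hCd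
  exact bsdp_three_of_exactIndexManin_of_wAllExclAddWildRankZero hGZ hKo hGZK hmod hGZ73 hRZ W hO6 hsurj hr
    (W.conductorNorm ℤ) K Dt H ι P (Cd • W.quadraticTwist (NumberField.discr K : ℚ)) rfl hK hodd hHH hLd hP
    ⟨Cd, rfl⟩ hlo hup

/-- **The UNION, mod-`3` image only (NO tower binder)**: for `E` on `ClassO6 W 3`, `r_an = 1`, `ρ̄_{E,3}` onto,
ONE Heegner datum at level `N_E` with odd `d_K` and `L(E^{d_K},1) ≠ 0`: global `3^{s′}`-divisibility on the frame
to depth `ord₃ ∏_ℓ c_ℓ(E) + v₃(c)` (Kolyvagin side, displayed) + Matar–Nekovář (named) + STEP L at slack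
`v₃(c)` (IMC side, hypothesis) + the named facts + the leaf `WAllExclAddWildRankZero` ⟹ `BSDp W 3`. Habitat:
the whole onto-W rank-one row (the target cell `W-ALL/2@3.O6.r1.surj`). CONDITIONAL; per datum.
[cite: MatarNekovar2019, Thm. 0.7 (p. 456) and §0.11 (p. 457)] [cite: JetchevSkinnerWan2017, §7.4.1 (arXiv:1512.06894 p. 30)] -/
theorem bsdp_three_of_globalDivisibility_of_stepL_of_wAllExclAddWildRankZero_of_surj
    (hGZ : ∀ (N : ℕ) [NeZero N] (W : WeierstrassCurve ℚ) (K : Type) [Field K] [NumberField K],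
      gross_zagier N W K)
    (hKo : ∀ (N : ℕ) [NeZero N] (W : WeierstrassCurve ℚ) (K : Type) [Field K] [NumberField K],
      kolyvagin N W K)
    (hGZK : rank_eq_analyticRank_of_analyticRank_le_one) (hmod : hasEntireLFunction_rat)
    (hGZ73 : GrossZagier1986_thm_I_7_3)
    (hMN : MatarNekovar2019.thm07_padicValNat_card_sha_primary_add_le_of_globalDivisibility_of_irreducible)
    (hRZ : Summit.BirchSwinnertonDyer.WAllExclAddWildRankZero)
    (W : WeierstrassCurve ℚ) [W.IsElliptic] [W.IsGloballyMinimal] [NeZero (W.conductorNorm ℤ)]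
    (hO6 : ClassO6 W 3) (hsurj : W.HasSurjectiveModNGaloisRep 3) (hr : W.analyticRank = 1)
    (K : Type) [Field K] [NumberField K]
    (Dt : ModularParametrizationData W (W.conductorNorm ℤ))
    (H : HeegnerDatum (W.conductorNorm ℤ) (NumberField.discr K)) (ι : K →+* ℂ)
    (P : (W.baseChange K).toAffine.Point)
    (hK : IsImaginaryQuadratic K) (hodd : Odd (NumberField.discr K))
    (hHH : SatisfiesHeegnerHypothesis (W.conductorNorm ℤ) K)
    (hLd : (W.quadraticTwist (NumberField.discr K : ℚ)).entireLFunction 1 ≠ 0)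
    (hP : WeierstrassCurve.Affine.Point.map ι.toRatAlgHom P = heegnerPointComplex Dt H)
    (hglob : ∀ (s' : ℕ), s' ≤ padicValNat 3 W.tamagawaProduct + padicValNat 3 Dt.c.natAbs →
      ∀ (n : ℕ) (d : KolyvaginHeegnerData Dt H.β ι n), Squarefree n →
        (∀ ℓ ∈ n.primeFactors, Zhang2014.IsKolyvaginPrime (W.conductorNorm ℤ) W K 3 ℓ ∧
          s' ≤ Zhang2014.kolyvaginIndex W 3 ℓ) → Koly.PDiv d 3 s')
    (hlo : IndexLowerBoundLeAt W 3 K P (padicValNat 3 Dt.c.natAbs)) :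
    BSDp W 3 := by
  have h3N : 3 ∣ W.conductorNorm ℤ :=
    (W.dvd_conductorNorm_iff_not_hasGoodReductionAtPrime 3).mpr (not_good_of_addv W 3 hO6.2.1)
  have h3 : NumberField.discr K ≠ -3 := by
    intro h
    exact (X11b.Three.not_dvd_discr_and_not_dvd_torsionOrder_of_heegner hK hHH (by decide) h3N).1
      (h ▸ ⟨-1, by norm_num⟩)
  have h4 : NumberField.discr K ≠ -4 := by
    intro h
    rw [h] at hodd
    exact (Int.not_odd_iff_even.mpr ⟨-2, by norm_num⟩) hodd
  have hL0 : W.entireLFunction 1 = 0 := entireLFunction_one_eq_zero_of_analyticRank_eq_one hr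
  obtain ⟨-, hderiv⟩ := leadingLCoeff_eq_deriv_of_analyticRank_eq_one hr
  have hLK : LDerivEK W K ≠ 0 := by
    rw [lDerivEK_eq_deriv_mul W K hmod hL0]; exact mul_ne_zero hderiv hLd
  have hnt : ¬ IsOfFinAddOrder P :=
    (lDerivEK_ne_zero_iff_not_isOfFinAddOrder W (W.conductorNorm ℤ) K (hGZ _ W K) hK hHH
      ⟨Dt, H, ι, hP⟩).mp hLK
  have hup : Upper.IndexUpperBoundLeAt W 3 K P (padicValNat 3 Dt.c.natAbs) :=
    upper_of_globalDivisibility_of_surj hKo hMN W 3 (by decide) hsurj K hK h3 h4 hHH Dt H ι P hP hnt hglob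
  have hD0 : (NumberField.discr K : ℚ) ≠ 0 := by exact_mod_cast NumberField.discr_ne_zero K
  haveI : (W.quadraticTwist (NumberField.discr K : ℚ)).IsElliptic := W.isElliptic_quadraticTwist hD0
  obtain ⟨Cd, hCd⟩ := hasGlobalMinimalModel_rat_holds (W.quadraticTwist (NumberField.discr K : ℚ))
  haveI : (Cd • W.quadraticTwist (NumberField.discr K : ℚ)).IsGloballyMinimal := hCd
  exact bsdp_three_of_exactIndexManin_of_wAllExclAddWildRankZero hGZ hKo hGZK hmod hGZ73 hRZ W hO6 hsurj hr
    (W.conductorNorm ℤ) K Dt H ι P (Cd • W.quadraticTwist (NumberField.discr K : ℚ)) rfl hK hodd hHH hLd hP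
    ⟨Cd, rfl⟩ hlo hup

end Summit.BirchSwinnertonDyer.BirchSwinnertonDyer.Theorems.SchneiderFree.Exact

end
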